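import Summits.QuantumFields.QCD.Theses.EulerDescent
import Summits.QuantumFields.QCD.Theorems.MassiveBody.Negative.MassBlind
import Summits.QuantumFields.QCD.Theorems.GluonicCompletion.Negative.Threshold

/-!
# Disproof of `RetypedContinuumComplement` (crux stmt-QuantumFields-16903, route EulerDescent) — findings

Standing disprover `refuter-cdisprove-stmt-QuantumFields-16903-0`, cycle 1 (2026-08-17).  The crux:

  `∀ N_f ∈ {2,3}, ∀ reg, (H1) HasMassScaling → (H2) (reg.scheme 0 0 0).HasAsymptoticScaling →
   (H3) (∀ᶠ k, −1 < m_crit k) → (H4) HeavyBody reg → (H5) GapEverywhere reg → ∀ m > 0, Body reg m`.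

**VERDICT OF THE CHEAP ATTACKS: no kill, and none is possible in the present tree.**  Every
counter-model `reg` must carry (H4) — non-trivial OS data with dynamical flavour-changing
pseudoscalars as the FULL-SEQUENCE continuum limit of honest lattice QCD at heavy masses — which the
tree cannot construct; the junk inhabitants of the body's shape (`z ≡ 0` ⇒ vacuum data,
`isQCDAlong_zeroAF_vacuum`; constant fields via `shift`) all fail `IsNontrivial`
(`OSData.not_isNontrivial_vacuum`).  Symmetrically no hypothesis is refutable, so the crux is neither
vacuous nor cheaply false.  What this file records instead (all `sorry`-free unless marked):

* §1 `hasAsymptoticScaling_of_heavyBody`, `crux_iff_withoutAF` — **(H2) is NOT load-bearing**: it is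
  a field of `IsQCDAlong` inside (H4) (any heavy tuple), and `HasAsymptoticScaling` never reads the
  masses or species renormalisations.  (H3) is load-bearing at exactly one place — the branch clause
  of `IsQCDAlong` at LIGHT masses — and (H4) only gives `−1 − a_k M_h/Z_m(k) < m_crit k`
  (`weakBranch_of_heavyBody`); a certificate would need a heavy body at `m_crit ≈ −1` (unconstructible).
* §2 **(H5) THE LATTICE GAP IS LOAD-BEARING** — `body_all_of_withoutGap`: drop (H5) and the crux,
  applied to the DOWN-shifted regularisation `m_crit ↦ m_crit − a_k c/Z_m(k)` (threshold-shift symmetry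
  `GluonicCompletion.Negative.scheme_mcrit_shift`, the hypotheses (H1)(H2)(H4) being blind to it and
  (H3) surviving for regularisations on the deep branch), yields the `QCDOf` body at EVERY REAL mass
  tuple — at the chiral point `m = 0` and at negative renormalised masses — along any regularisation
  carrying heavy QCD.  `withoutGap_false_of_gaplessChiralPoint`: hence `¬ (crux − H5)` modulo the
  physical input "some regularisation carrying heavy QCD has no uniform lattice gap AT zero mass"
  (Goldstone).  Any proof must consume the light-mass lattice gap (the line does: V2/S2).
* §3 **THE FULL-SEQUENCE CLAUSE OF (H4) IS LOAD-BEARING** — `massBlind_of_subseqCrux`: weaken (H4) to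
  "the heavy body holds along a SUBSEQUENCE of `reg`" and the crux, applied to the period-two
  interleaving of an honest `reg` with its RGI up-shift by `M` (`MassiveBody.Negative.exists_interleave`;
  (H1)(H2)(H3)(H5) and the weakened (H4) all pass to the interleaving), yields MASS-BLIND continuum
  data: one `T` that is `IsQCDAlong` both `reg.scheme m` and `reg.scheme (m + M·1)`, for every `M ≥ 0`
  and every positive `m` — against `m_π² ∝ m_q`.  `subseqCrux_false_of_massResolving`: `¬ (crux with
  subsequential H4)` modulo "QCD continuum data resolve a quark-mass shift".  So a proof must use
  CONVERGENCE ALONG THE WHOLE SEQUENCE at heavy masses, not merely subsequential limits / compactness —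
  exactly the identity-theorem use the picked line `vitali-mass-descent` makes of it (heavy segment =
  uniqueness set).  A compactness-only proof would prove the absurd subsequential variant.
* §4 `-- Line vitali-mass-descent` (targets: none stuck; payload `stuck_stubs = []`): V1
  `LiveRecalibration` and V2 `AnalyticRayCollar` carry the crux hypotheses verbatim (H4 included), so
  they resist every cheap attack for the same reason as the crux; the 𝒞-freedom of V2's `∀ 𝒞` is
  killed by `z_pos` + `BitesOnCompacts` (canonical `z = C_bare^{-1/2}`, `shift` = bare one-point), so no
  sign-flip / non-analytic-calibration counterexample exists; at `L = 1` V2 is exactly eventual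
  `k`-boundedness of the calibrated function (`collarAtOne_iff_eventuallyBounded`, on a verbatim copy of
  `HasAnalyticCollar`'s shape) — UV stability in ratio form is INSIDE V2 already on the degenerate
  segment.  S2 = stmt-11525 and S3 = stmt-8840 have honest lattice gaps among their hypotheses: not
  instantiable here either.
* §5 NEAR-MISSES / why it resists (docstring only): interleaving and seam pathologies destroy (H4)
  itself; down-shifts need (H5) at non-positive masses; `N_f = 0` slice is `hyps = conclusion`
  (`crux_slice_zero`); decoupled `m_crit ≡ 20` regularisations need the YM lattice gap for (H5).

Landed / proposed from this file: `Theorems/RetypedContinuumComplement/Negative/LoadBearing.lean`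
(§1–§3).  Refs: MassBlind.lean (interleave machinery), Threshold.lean (shift symmetry),
Montvay–Münster §5.1 (additive mass renormalisation), Gell-Mann–Oakes–Renner 1968.
-/

noncomputable section

namespace Summit.QuantumFields.QCD.Cruxes.RetypedContinuumComplement.Disproof

open Filter Topology
open Literature.MathematicalPhysics.AQFT Literature.MathematicalPhysics.QuantumLattice
  Literature.MathematicalPhysics.QuantumFieldTheory
open Summit.QuantumFields.QCD.Theses.EulerDescent (RetypedContinuumComplement)
open Summit.QuantumFields.QCD.Theorems.MassiveBody.Negative
open Summit.QuantumFields.QCD.Theorems.GluonicCompletion.Negative (scheme_mcrit_shift)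

variable {Nf : ℕ}

/-! ## §0 Currency (verbatim sub-formulae of the crux) -/

/-- The `QCDOf` body of `reg` at the renormalised tuple `m` (verbatim the crux's matrix). -/
def Body (reg : QCDRegularisation Nf) (m : Fin Nf → ℝ) : Prop :=
  ∃ (z shift : QCDField Nf → ℕ → ℝ) (T : OSData (QCDField Nf) 4),
    IsQCDAlong (reg.scheme m z shift) T ∧ T.IsNontrivial QCDField.glue ∧ T.IsNonGaussian QCDField.glue ∧
      (∀ f g : Fin Nf, f ≠ g → T.IsNontrivial (QCDField.pseudoRe f g)) ∧
        ∃ Δ > 0, T.HasMassGap Δ ∧ (reg.scheme m z shift).HasLatticeMassGap Δ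

/-- (H4) the heavy body above some threshold. -/
def HeavyBody (reg : QCDRegularisation Nf) : Prop :=
  ∃ Mh : ℝ, 0 < Mh ∧ ∀ m : Fin Nf → ℝ, (∀ f, Mh ≤ m f) → Body reg m

/-- (H5) a uniform lattice gap at every positive tuple. -/
def GapEverywhere (reg : QCDRegularisation Nf) : Prop :=
  ∀ m : Fin Nf → ℝ, (∀ f, 0 < m f) → ∃ Δ > 0, (reg.scheme m 0 0).HasLatticeMassGap Δ

/-- The crux, re-read through the currency (definitional). -/
theorem crux_iff :
    RetypedContinuumComplement ↔
      ∀ Nf : ℕ, Nf = 2 ∨ Nf = 3 → ∀ reg : QCDRegularisation Nf, reg.HasMassScaling →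
        (reg.scheme 0 0 0).HasAsymptoticScaling → (∀ᶠ k in atTop, (-1 : ℝ) < reg.mcrit k) →
          HeavyBody reg → GapEverywhere reg → ∀ m : Fin Nf → ℝ, (∀ f, 0 < m f) → Body reg m :=
  Iff.rfl

/-! ## §1 (H2) is redundant; what (H4) gives towards (H3) -/

/-- **(H2) follows from (H4)**: asymptotic scaling is a field of `IsQCDAlong` at any heavy tuple and
reads neither the masses nor the species renormalisations. -/
theorem hasAsymptoticScaling_of_heavyBody (reg : QCDRegularisation Nf) (h : HeavyBody reg) :
    (reg.scheme 0 0 0).HasAsymptoticScaling := by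
  obtain ⟨Mh, _, hb⟩ := h
  obtain ⟨z, shift, T, hQ, -⟩ := hb (fun _ => Mh) (fun _ => le_rfl)
  exact hQ.1

/-- The crux with hypothesis (H2) deleted. -/
def RetypedContinuumComplementWithoutAF : Prop :=
  ∀ Nf : ℕ, Nf = 2 ∨ Nf = 3 → ∀ reg : QCDRegularisation Nf, reg.HasMassScaling →
    (∀ᶠ k in atTop, (-1 : ℝ) < reg.mcrit k) →
      HeavyBody reg → GapEverywhere reg → ∀ m : Fin Nf → ℝ, (∀ f, 0 < m f) → Body reg m

/-- **(H2) is not load-bearing**: deleting it does not change the proposition. -/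
theorem crux_iff_withoutAF : RetypedContinuumComplement ↔ RetypedContinuumComplementWithoutAF :=
  ⟨fun h Nf hNf reg hms hbr hheavy hgap m hm =>
      h Nf hNf reg hms (hasAsymptoticScaling_of_heavyBody reg hheavy) hbr hheavy hgap m hm,
    fun h Nf hNf reg hms _ hbr hheavy hgap m hm => h Nf hNf reg hms hbr hheavy hgap m hm⟩

/-- **What (H4) gives towards (H3)**: only `−1 − a_k M_h / Z_m(k) < m_crit(k)` eventually (the branch
clause of the heavy degenerate tuple), a window of width `O(a_k/Z_m(k))` short of (H3).  (H3) itself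
is consumed by the branch clause of `IsQCDAlong` at LIGHT tuples; no cheap certificate of its
load-bearing status exists (it would need a heavy body at `m_crit ≈ −1`). -/
theorem weakBranch_of_heavyBody (reg : QCDRegularisation Nf) (hNf : Nf ≠ 0) (h : HeavyBody reg) :
    ∃ Mh : ℝ, 0 < Mh ∧ ∀ᶠ k in atTop, (-1 : ℝ) - reg.a k * Mh / reg.Zm k < reg.mcrit k := by
  obtain ⟨Mh, hMh, hb⟩ := h
  obtain ⟨z, shift, T, hQ, -⟩ := hb (fun _ => Mh) (fun _ => le_rfl)
  refine ⟨Mh, hMh, ?_⟩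
  have hbr := hQ.2.1 ⟨0, Nat.pos_of_ne_zero hNf⟩
  filter_upwards [hbr] with k hk
  rw [QCDRegularisation.scheme_mq] at hk
  linarith

/-- The `N_f = 0` slice is `hypothesis = conclusion` (the tuple type is a singleton): no content and
no counterexample lives there. -/
theorem crux_slice_zero (reg : QCDRegularisation 0) (h : HeavyBody reg) (m : Fin 0 → ℝ) : Body reg m := by
  obtain ⟨Mh, _, hb⟩ := h
  have : m = fun _ => Mh := funext fun i => i.elim0
  subst this
  exact hb _ fun _ => le_rfl

/-! ## §2 (H5) is load-bearing: without the light-mass lattice gap the crux descends through zero mass -/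

/-- The crux with hypothesis (H5) deleted. -/
def RetypedContinuumComplementWithoutGap : Prop :=
  ∀ Nf : ℕ, Nf = 2 ∨ Nf = 3 → ∀ reg : QCDRegularisation Nf, reg.HasMassScaling →
    (reg.scheme 0 0 0).HasAsymptoticScaling → (∀ᶠ k in atTop, (-1 : ℝ) < reg.mcrit k) →
      HeavyBody reg → ∀ m : Fin Nf → ℝ, (∀ f, 0 < m f) → Body reg m

/-- The RGI shift of the flavour-blind critical mass by `M₀` (up for `M₀ > 0`, DOWN for `M₀ < 0`). -/
def shiftReg (reg : QCDRegularisation Nf) (M₀ : ℝ) : QCDRegularisation Nf :=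
  { reg with mcrit := fun k => reg.mcrit k + reg.a k * M₀ / reg.Zm k }

/-- The shifted regularisation at `m` is the original at `M₀ + m`
(`GluonicCompletion.Negative.scheme_mcrit_shift`). -/
theorem shiftReg_scheme (reg : QCDRegularisation Nf) (M₀ : ℝ) (m : Fin Nf → ℝ)
    (z shift : QCDField Nf → ℕ → ℝ) :
    (shiftReg reg M₀).scheme m z shift = reg.scheme (fun f => M₀ + m f) z shift :=
  scheme_mcrit_shift reg M₀ m z shift

/-- The body is transported by the shift. -/
theorem body_shiftReg_iff (reg : QCDRegularisation Nf) (M₀ : ℝ) (m : Fin Nf → ℝ) :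
    Body (shiftReg reg M₀) m ↔ Body reg (fun f => M₀ + m f) := by
  simp only [Body, shiftReg_scheme]

/-- Mass scaling does not read `m_crit`. -/
theorem hasMassScaling_shiftReg_iff (reg : QCDRegularisation Nf) (M₀ : ℝ) :
    (shiftReg reg M₀).HasMassScaling ↔ reg.HasMassScaling := Iff.rfl

/-- Asymptotic scaling does not read `m_crit`. -/
theorem hasAsymptoticScaling_shiftReg_iff (reg : QCDRegularisation Nf) (M₀ : ℝ) :
    ((shiftReg reg M₀).scheme 0 0 0).HasAsymptoticScaling ↔ (reg.scheme 0 0 0).HasAsymptoticScaling := by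
  rw [shiftReg_scheme]; exact Iff.rfl

/-- The heavy body passes to every shift (threshold `M_h + |M₀|`). -/
theorem heavyBody_shiftReg (reg : QCDRegularisation Nf) (M₀ : ℝ) (h : HeavyBody reg) :
    HeavyBody (shiftReg reg M₀) := by
  obtain ⟨Mh, hMh, hb⟩ := h
  refine ⟨Mh + |M₀|, by positivity, fun m hm => ?_⟩
  rw [body_shiftReg_iff]
  exact hb _ fun f => by have := hm f; have := neg_abs_le M₀; linarith

/-- **Dropping (H5) makes the crux prove the body at EVERY REAL mass tuple** (zero and negative
renormalised masses included) along any regularisation carrying heavy QCD whose critical mass stays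
on the deep branch (`−1 < m_crit(k) + a_k c/Z_m(k)` eventually for every real `c` — true whenever
`liminf m_crit > −1`, e.g. the honest `m_crit(k) → 0⁻`): apply the gap-less crux to the DOWN-shift by
`c = 1 + Σ_f |m_f|`, which carries (H1)(H2)(H3)(H4) again, at the positive tuple `m + c·1`. -/
theorem body_all_of_withoutGap (h : RetypedContinuumComplementWithoutGap) (hNf : Nf = 2 ∨ Nf = 3)
    (reg : QCDRegularisation Nf) (hms : reg.HasMassScaling)
    (haf : (reg.scheme 0 0 0).HasAsymptoticScaling)
    (hdeep : ∀ c : ℝ, ∀ᶠ k in atTop, (-1 : ℝ) < reg.mcrit k + reg.a k * c / reg.Zm k)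
    (hheavy : HeavyBody reg) (m : Fin Nf → ℝ) : Body reg m := by
  set c : ℝ := 1 + ∑ f, |m f| with hc
  have hcpos : ∀ f, 0 < c + m f := by
    intro f
    have h1 : |m f| ≤ ∑ g, |m g| := Finset.single_le_sum (fun g _ => abs_nonneg (m g)) (Finset.mem_univ f)
    have h2 := neg_abs_le (m f)
    rw [hc]; linarith
  have key := h Nf hNf (shiftReg reg (-c)) ((hasMassScaling_shiftReg_iff reg _).2 hms)
    ((hasAsymptoticScaling_shiftReg_iff reg _).2 haf) (hdeep (-c)) (heavyBody_shiftReg reg _ hheavy)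
    (fun f => c + m f) hcpos
  rw [body_shiftReg_iff] at key
  have e : (fun f => -c + (c + m f)) = m := funext fun f => by ring
  rwa [e] at key

/-- In particular the gap-less crux puts a uniform lattice gap AT THE CHIRAL POINT `m = 0` of every such
regularisation. -/
theorem latticeGap_at_zero_of_withoutGap (h : RetypedContinuumComplementWithoutGap) (hNf : Nf = 2 ∨ Nf = 3)
    (reg : QCDRegularisation Nf) (hms : reg.HasMassScaling)
    (haf : (reg.scheme 0 0 0).HasAsymptoticScaling)
    (hdeep : ∀ c : ℝ, ∀ᶠ k in atTop, (-1 : ℝ) < reg.mcrit k + reg.a k * c / reg.Zm k)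
    (hheavy : HeavyBody reg) : ∃ Δ > 0, (reg.scheme 0 0 0).HasLatticeMassGap Δ := by
  obtain ⟨z, shift, T, -, -, -, -, Δ, hΔ, -, hlat⟩ := body_all_of_withoutGap h hNf reg hms haf hdeep hheavy 0
  exact ⟨Δ, hΔ, hlat⟩

/-- **`¬ (crux − H5)` modulo a gapless chiral point.**  If some `N_f ∈ {2,3}` regularisation on the deep
branch carries heavy QCD (H1,H2,H4) and has NO uniform lattice gap at zero renormalised mass (massless
`N_f ≥ 2` Wilson QCD pinned at the corner: Goldstone pions), the gap-less crux is false.  The physical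
input is believed but unconstructible here; this is a load-bearing certificate for (H5), not a
refutation of the crux. -/
theorem withoutGap_false_of_gaplessChiralPoint
    (H : ∃ Nf : ℕ, (Nf = 2 ∨ Nf = 3) ∧ ∃ reg : QCDRegularisation Nf, reg.HasMassScaling ∧
      (reg.scheme 0 0 0).HasAsymptoticScaling ∧
      (∀ c : ℝ, ∀ᶠ k in atTop, (-1 : ℝ) < reg.mcrit k + reg.a k * c / reg.Zm k) ∧ HeavyBody reg ∧
      ∀ Δ : ℝ, 0 < Δ → ¬ (reg.scheme 0 0 0).HasLatticeMassGap Δ) :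
    ¬ RetypedContinuumComplementWithoutGap := by
  rintro h
  obtain ⟨Nf, hNf, reg, hms, haf, hdeep, hheavy, hno⟩ := H
  obtain ⟨Δ, hΔ, hlat⟩ := latticeGap_at_zero_of_withoutGap h hNf reg hms haf hdeep hheavy
  exact hno Δ hΔ hlat

/-! ## §3 The full-sequence clause of (H4) is load-bearing: a subsequential heavy body makes QCD mass-blind -/

/-- **The heavy body ALONG A SUBSEQUENCE of `reg`**: some regularisation `reg₀` whose data are those of
`reg` read along a strictly increasing `φ` carries the heavy body (convergence of the honest lattice
functions only along `φ`). -/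
def SubseqHeavyBody (reg : QCDRegularisation Nf) : Prop :=
  ∃ (φ : ℕ → ℕ) (reg₀ : QCDRegularisation Nf), StrictMono φ ∧
    (∀ j, reg.a (φ j) = reg₀.a j) ∧ (∀ j, reg.β (φ j) = reg₀.β j) ∧ (∀ j, reg.L (φ j) = reg₀.L j) ∧
      (∀ j, reg.Zm (φ j) = reg₀.Zm j) ∧ (∀ j, reg.mcrit (φ j) = reg₀.mcrit j) ∧ HeavyBody reg₀

/-- The weakening is one: the heavy body is a subsequential heavy body (`φ = id`). -/
theorem subseqHeavyBody_of_heavyBody (reg : QCDRegularisation Nf) (h : HeavyBody reg) :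
    SubseqHeavyBody reg :=
  ⟨id, reg, strictMono_id, fun _ => rfl, fun _ => rfl, fun _ => rfl, fun _ => rfl, fun _ => rfl, h⟩

/-- The crux with (H4) weakened to a subsequential heavy body. -/
def RetypedContinuumComplementSubseq : Prop :=
  ∀ Nf : ℕ, Nf = 2 ∨ Nf = 3 → ∀ reg : QCDRegularisation Nf, reg.HasMassScaling →
    (reg.scheme 0 0 0).HasAsymptoticScaling → (∀ᶠ k in atTop, (-1 : ℝ) < reg.mcrit k) →
      SubseqHeavyBody reg → GapEverywhere reg → ∀ m : Fin Nf → ℝ, (∀ f, 0 < m f) → Body reg m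

/-- The subsequential variant implies the crux (it has a weaker hypothesis). -/
theorem crux_of_subseqCrux (h : RetypedContinuumComplementSubseq) : RetypedContinuumComplement :=
  fun Nf hNf reg hms haf hbr hheavy hgap m hm =>
    h Nf hNf reg hms haf hbr (subseqHeavyBody_of_heavyBody reg hheavy) hgap m hm

section Interleave

variable (reg reg' : QCDRegularisation Nf) (M : ℝ)
  (ha' : ∀ k, reg'.a k = reg.a (k / 2)) (hβ' : ∀ k, reg'.β k = reg.β (k / 2))
  (hL' : ∀ k, reg'.L k = reg.L (k / 2)) (hZ' : ∀ k, reg'.Zm k = reg.Zm (k / 2))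
  (hmc' : ∀ k, reg'.mcrit k =
    reg.mcrit (k / 2) + reg.a (k / 2) * (((k % 2 : ℕ) : ℝ) * M) / reg.Zm (k / 2))

include hmc' in
/-- (H3) passes to the interleaving (`M ≥ 0`: the odd critical masses are the even ones moved up). -/
theorem interleave_branch (hM : 0 ≤ M) (hbr : ∀ᶠ k in atTop, (-1 : ℝ) < reg.mcrit k) :
    ∀ᶠ k in atTop, (-1 : ℝ) < reg'.mcrit k := by
  obtain ⟨N, hN⟩ := eventually_atTop.1 hbr
  refine eventually_atTop.2 ⟨2 * N, fun k hk => ?_⟩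
  rw [hmc']
  have h1 : -1 < reg.mcrit (k / 2) := hN _ (by omega)
  have h2 : 0 ≤ reg.a (k / 2) * (((k % 2 : ℕ) : ℝ) * M) / reg.Zm (k / 2) :=
    div_nonneg (mul_nonneg (reg.a_pos _).le (mul_nonneg (Nat.cast_nonneg _) hM)) (reg.Zm_pos _).le
  linarith

include hmc' in
/-- Even critical masses are those of `reg`. -/
theorem interleave_mcrit_even (j : ℕ) : reg'.mcrit (2 * j) = reg.mcrit j := by
  have h1 : 2 * j / 2 = j := by omega
  have h2 : 2 * j % 2 = 0 := by omega
  rw [hmc', h1, h2]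
  simp

include ha' hβ' hL' hZ' hmc' in
/-- **The (full-sequence) heavy body of `reg` is a SUBSEQUENTIAL heavy body of the interleaving** (along
the even steps).  The full-sequence heavy body of the interleaving itself is NOT available: it would be
one limit for the theories at `m` and at `m + M·1`. -/
theorem interleave_subseqHeavyBody (h : HeavyBody reg) : SubseqHeavyBody reg' :=
  ⟨fun j => 2 * j, reg, fun a b hab => by dsimp only; omega, (interleave_a_eq reg reg' ha').1,
    (interleave_β_eq reg reg' hβ').1, (interleave_L_eq reg reg' hL').1,
    fun j => by show reg'.Zm (2 * j) = reg.Zm j; rw [hZ']; congr 1; omega,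
    interleave_mcrit_even reg reg' M hmc', h⟩

include ha' hβ' hL' hZ' hmc' in
/-- **(H5) passes to the interleaving** (`M ≥ 0`): at `m` the even steps carry `reg`'s gap at `m`, the odd
steps `reg`'s gap at `m + M·1`; take the smaller rate. -/
theorem interleave_gapEverywhere (hM : 0 ≤ M) (h : GapEverywhere reg) : GapEverywhere reg' := by
  intro m hm
  obtain ⟨Δ₀, hΔ₀, h₀⟩ := h m hm
  obtain ⟨Δ₁, hΔ₁, h₁⟩ := h (fun f => m f + M) (fun f => by linarith [hm f])
  refine ⟨min Δ₀ Δ₁, lt_min hΔ₀ hΔ₁, ?_⟩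
  exact latticeGap_interleave (latticeGap_mono h₀ (min_le_left _ _)) (latticeGap_mono h₁ (min_le_right _ _))
    (interleave_L_eq reg reg' hL').1 (interleave_β_eq reg reg' hβ').1 (interleave_a_eq reg reg' ha').1
    (interleave_mq_even reg reg' M ha' hZ' hmc' m 0 0 0 0)
    (interleave_L_eq reg reg' hL').2 (interleave_β_eq reg reg' hβ').2 (interleave_a_eq reg reg' ha').2
    (interleave_mq_odd reg reg' M ha' hZ' hmc' m 0 0 0 0)

end Interleave

/-- **The subsequential crux makes QCD mass-blind.**  For `N_f ∈ {2,3}`, every regularisation `reg`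
satisfying ALL FIVE hypotheses of the genuine crux (heavy body along the full sequence included),
every shift `M ≥ 0` and every positive tuple `m`, the variant `RetypedContinuumComplementSubseq` yields
ONE `T` — non-trivial non-Gaussian glue, non-decoupled flavoured pseudoscalars, a mass gap — that is QCD
along `reg` BOTH at masses `m` and at masses `m + M·1`, with a common uniform lattice gap.  Proof: the
interleaving of `reg` with its up-shift by `M` satisfies (H1)(H2)(H3)(H5) and the subsequential (H4);
split the variant's conclusion along even and odd steps. -/
theorem massBlind_of_subseqCrux (h : RetypedContinuumComplementSubseq) (hNf : Nf = 2 ∨ Nf = 3)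
    (reg : QCDRegularisation Nf) (hms : reg.HasMassScaling)
    (haf : (reg.scheme 0 0 0).HasAsymptoticScaling) (hbr : ∀ᶠ k in atTop, (-1 : ℝ) < reg.mcrit k)
    (hheavy : HeavyBody reg) (hgap : GapEverywhere reg) {M : ℝ} (hM : 0 ≤ M)
    (m : Fin Nf → ℝ) (hm : ∀ f, 0 < m f) :
    ∃ (T : OSData (QCDField Nf) 4) (z₁ s₁ z₂ s₂ : QCDField Nf → ℕ → ℝ),
      IsQCDAlong (reg.scheme m z₁ s₁) T ∧ IsQCDAlong (reg.scheme (fun f => m f + M) z₂ s₂) T ∧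
      T.IsNontrivial QCDField.glue ∧ T.IsNonGaussian QCDField.glue ∧
      (∀ f g : Fin Nf, f ≠ g → T.IsNontrivial (QCDField.pseudoRe f g)) ∧
      ∃ Δ > 0, T.HasMassGap Δ ∧ (reg.scheme m 0 0).HasLatticeMassGap Δ ∧
        (reg.scheme (fun f => m f + M) 0 0).HasLatticeMassGap Δ := by
  obtain ⟨reg', ha', hβ', hL', hZ', hmc'⟩ := exists_interleave reg M
  have hms' := interleave_hasMassScaling reg reg' ha' hZ' hms
  have haf' := interleave_hasAsymptoticScaling reg reg' ha' hβ' haf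
  have hbr' := interleave_branch reg reg' M hmc' hM hbr
  have hheavy' := interleave_subseqHeavyBody reg reg' M ha' hβ' hL' hZ' hmc' hheavy
  have hgap' := interleave_gapEverywhere reg reg' M ha' hβ' hL' hZ' hmc' hM hgap
  obtain ⟨z, s, T, hQ, hnt, hng, hps, Δ, hΔ, hT, hlat⟩ := h Nf hNf reg' hms' haf' hbr' hheavy' hgap' m hm
  refine ⟨T, fun s' j => z s' (2 * j), fun s' j => s s' (2 * j), fun s' j => z s' (2 * j + 1),
    fun s' j => s s' (2 * j + 1), ?_, ?_, hnt, hng, hps, Δ, hΔ, hT, ?_, ?_⟩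
  · exact isQCDAlong_along (fun j => 2 * j) (fun j => by omega) hQ haf
      (interleave_L_eq reg reg' hL').1 (interleave_β_eq reg reg' hβ').1 (interleave_a_eq reg reg' ha').1
      (interleave_mq_even reg reg' M ha' hZ' hmc' m z s _ _) (fun _ => rfl) (fun _ => rfl)
  · exact isQCDAlong_along (fun j => 2 * j + 1) (fun j => by omega) hQ haf
      (interleave_L_eq reg reg' hL').2 (interleave_β_eq reg reg' hβ').2 (interleave_a_eq reg reg' ha').2
      (interleave_mq_odd reg reg' M ha' hZ' hmc' m z s _ _) (fun _ => rfl) (fun _ => rfl)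
  · exact latticeGap_along (fun j => 2 * j) (fun j => by omega) hlat
      (interleave_L_eq reg reg' hL').1 (interleave_β_eq reg reg' hβ').1 (interleave_a_eq reg reg' ha').1
      (interleave_mq_even reg reg' M ha' hZ' hmc' m z s 0 0)
  · exact latticeGap_along (fun j => 2 * j + 1) (fun j => by omega) hlat
      (interleave_L_eq reg reg' hL').2 (interleave_β_eq reg reg' hβ').2 (interleave_a_eq reg reg' ha').2
      (interleave_mq_odd reg reg' M ha' hZ' hmc' m z s 0 0)

/-- **`¬ (crux with subsequential H4)` modulo mass resolution.**  If along some regularisation satisfying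
all five hypotheses of the genuine crux the continuum data RESOLVE some quark-mass shift `M > 0` at some
positive tuple (no OS data with non-trivial glue are QCD along `reg` both at `m` and at `m + M·1` —
`m_π² ∝ m_q`, any mass dependence of any hadronic quantity), the subsequential variant is false.  So a
proof of the crux cannot get by with subsequential limits / compactness extracted from (H4): it must
use convergence along the WHOLE sequence at heavy masses (the line's identity-theorem step). -/
theorem subseqCrux_false_of_massResolving
    (H : ∃ Nf : ℕ, (Nf = 2 ∨ Nf = 3) ∧ ∃ reg : QCDRegularisation Nf, reg.HasMassScaling ∧
      (reg.scheme 0 0 0).HasAsymptoticScaling ∧ (∀ᶠ k in atTop, (-1 : ℝ) < reg.mcrit k) ∧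
      HeavyBody reg ∧ GapEverywhere reg ∧
      ∃ M : ℝ, 0 < M ∧ ∃ m : Fin Nf → ℝ, (∀ f, 0 < m f) ∧
        ∀ (T : OSData (QCDField Nf) 4) (z₁ s₁ z₂ s₂ : QCDField Nf → ℕ → ℝ),
          IsQCDAlong (reg.scheme m z₁ s₁) T → IsQCDAlong (reg.scheme (fun f => m f + M) z₂ s₂) T →
            ¬ T.IsNontrivial QCDField.glue) :
    ¬ RetypedContinuumComplementSubseq := by
  intro h
  obtain ⟨Nf, hNf, reg, hms, haf, hbr, hheavy, hgap, M, hM, m, hm, hres⟩ := H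
  obtain ⟨T, z₁, s₁, z₂, s₂, h₁, h₂, hnt, -⟩ :=
    massBlind_of_subseqCrux h hNf reg hms haf hbr hheavy hgap hM.le m hm
  exact hres T z₁ s₁ z₂ s₂ h₁ h₂ hnt

/-! ## §4 Line `vitali-mass-descent` (picked; 4 stubs V1 V2 S2 S3; no stuck stubs yet)

No stub is cheaply refutable: V1 `LiveRecalibration` and V2 `AnalyticRayCollar` carry (H1)–(H5)
verbatim, hence need the unconstructible heavy body to instantiate; S2 (stmt-11525) and S3 (stmt-8840)
carry honest uniform lattice gaps.  Cheap typing probes run on V2 (`∀ 𝒞 : CalibratedSpeciesFamily reg,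
BitesOnCompacts 𝒞 → … HasAnalyticCollar 𝒞 m L n σ f`):
* the `∀ 𝒞` gives no sign / non-analytic-calibration loophole — `CalibratedSpeciesFamily.z_pos` and
  `BitesOnCompacts` pin `z_s(l•m,k) = C_bare^{-1/2}` on the whole segment eventually, `IsOnePointSubtracted`
  pins `shift`; null species `pseudoIm f f` insert `0`, their `shift` is forced to `0` wherever the
  partition function is non-zero, which biting forces on the segment;
* the off-diagonal tensor `F` enters V2 only through its EXISTENCE (the conclusion does not mention `F`):
  harmless — for `n = 1` every `F` qualifies but one-point functions vanish identically
  (`IsOnePointSubtracted`), `G := 0`;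
* at `L = 1` the collar is exactly eventual `k`-boundedness (below, on a verbatim copy of the shape of
  `HasAnalyticCollar` with the lattice function abstracted to a sequence `S : ℕ → ℝ → ℂ`): UV stability
  in ratio form (`DiagonalSpine.CalibratedTightness` (ii)) is inside V2 already on the degenerate segment,
  so V2 is at least as hard as that open item — information, not a kill.
-/

/-- Shape of the line's `HasAnalyticCollar 𝒞 m L n σ f`, with the calibrated lattice function along the
ray abstracted to `S k l` (`= qcdLatticeSchwinger (𝒞.scheme (l • m)) k n σ f`). -/
def CollarShape (S : ℕ → ℝ → ℂ) (L : ℝ) : Prop :=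
  ∃ U : Set ℂ, IsOpen U ∧ IsPreconnected U ∧ (∀ l : ℝ, l ∈ Set.Icc 1 L → ((l : ℂ) ∈ U)) ∧
    ∃ (C : ℝ) (G : ℕ → ℂ → ℂ), (∀ k, DifferentiableOn ℂ (G k) U) ∧ (∀ k, ∀ w ∈ U, ‖G k w‖ ≤ C) ∧
      ∀ᶠ k in atTop, ∀ l : ℝ, l ∈ Set.Icc 1 L → G k (l : ℂ) = S k l

/-- **The degenerate segment `L = 1`: the collar is eventual `k`-boundedness at the tuple itself.** -/
theorem collarAtOne_iff_eventuallyBounded (S : ℕ → ℝ → ℂ) :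
    CollarShape S 1 ↔ ∃ C : ℝ, ∀ᶠ k in atTop, ‖S k 1‖ ≤ C := by
  constructor
  · rintro ⟨U, -, -, hseg, C, G, -, hGb, hGeq⟩
    refine ⟨C, ?_⟩
    filter_upwards [hGeq] with k hk
    rw [← hk 1 ⟨le_rfl, le_rfl⟩]
    exact hGb k _ (hseg 1 ⟨le_rfl, le_rfl⟩)
  · rintro ⟨C, hC⟩
    classical
    refine ⟨Metric.ball (1 : ℂ) 1, Metric.isOpen_ball, (convex_ball (1 : ℂ) 1).isPreconnected, ?_,
      max C 0, fun k _ => if ‖S k 1‖ ≤ C then S k 1 else 0, fun k => differentiableOn_const _,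
      fun k w _ => ?_, ?_⟩
    · intro l hl
      have : l = 1 := le_antisymm hl.2 hl.1
      subst this
      simp
    · dsimp only
      split_ifs with hk
      · exact hk.trans (le_max_left _ _)
      · simp
    · filter_upwards [hC] with k hk l hl
      have : l = 1 := le_antisymm hl.2 hl.1
      subst this
      simp [hk]

/-! ## §5 Near-misses and why the crux resists (prose record; nothing to land)

* Interleaving `reg` with ANY inequivalent twin (shifted masses, rescaled units at equal leading log,
  other volumes) preserves (H1)(H2)(H3)(H5) but destroys (H4): the interleaved honest lattice functions
  at a heavy tuple would have to converge to ONE `T` (§3 is the exact residue of this attack).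
* Down-shifting `m_crit` needs (H5) at non-positive renormalised masses (§2 is the residue).
* Volume / periodic-seam pathologies (slow `a_k L_k → ∞`) are UV-dominated and mass-insensitive, so they
  break (H4) before they break the conclusion (strategist census (ii), confirmed on reading
  `qcdLatticeSchwinger`: the box truncation is the same at every mass).
* Decoupled regularisations (`m_crit ≡ 20`: positive Wilson determinant, convergent hopping expansion,
  configuration-wise propagator decay `(8κ)^{|x−y|}`) would refute the STRENGTHENING "(H5) alone ⇒ body"
  — but their (H5) is the uniform lattice gap of `SU(3)` Yang–Mills along an asymptotically free
  sequence (unprovable here), and for the crux itself they carry no heavy body with dynamical quarks.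
* `N_f = 0`: `hyps = conclusion` (`crux_slice_zero`); `N_f = 1`: no flavour-changing species, still needs (H4).
* Junk zeros: `qcdLatticeSchwinger`/`qcdTorusExpect` return `0` when the averaged signed Wilson
  determinant vanishes; for `N_f = 2` degenerate it is `∫ det² > 0`; for split masses / `N_f = 3` at bare
  masses near `m_crit < 0` real zeros of `Z_k(l)` on a mass ray are not excluded by anything in the tree
  (barrier `WilsonDeterminantSign`) — this bites V2's real-analyticity premise only where biting fails,
  and biting is V2's hypothesis on the segment; no counterexample results.
-/

end Summit.QuantumFields.QCD.Cruxes.RetypedContinuumComplement.Disproof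

end
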